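import Summits.ABC.IUTFork.Joshi.FundamentalEstimateBLStandard
import Summits.ABC.IUTFork.Joshi.ThetaJoshiConstruction
import HarnessLib

/-!
# Joshi, ATS III Prop. 6.6.1 «`ξ_1 = q`» — the two readings and Thm. 7.3.1's local step (kernel note for the referee lanes)

Record-only companion note of the abc-iut cell, block E (rung LADDER-ABC:A2.E), seat abc-iut-E-t11 (slot T-11), to the
faithfulness flag (F-1) on `ATS3.AdelicLiftDatum.XiOneIsTateParameter` (`Joshi/ThetaJoshiLocusBE.lean`, p429036): K. Joshi,
arXiv:2401.13508 **v4** (unrefereed; bib `Joshi2024ATS3`) prints in Prop. 6.6.1 (p. 48 l. 45–49) and again in the proof of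
Thm. 7.3.1 (p. 56 l. 29–37: «`α_w` is an `ℓ⋇`-tuple of Teichmüller lifts of the tuple `(q_{w,j})_{j=1,…,ℓ⋇}` consisting of the Tate
parameters … computed in the `ℓ⋇`-tuple of residue fields `(K_{y_{w,j}})`») that the lifted residue classes ARE the Tate
parameters, while the theta value `ξ_1` of [J-IIp] = arXiv:2303.01662v3 §5.1 (bib `Joshi2023ATS2Local`; slot E-t3) has
`|ξ_1| = |q^{1/2ℓ}|`, and Thm. 7.3.1's bound is `∏_w |q_w^{1/2ℓ}|^{ℓ⋇}` (p. 55 l. 13–30). This file records TWO KERNEL FACTS about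
the two readings, over slot T-12's landed §7 signature `ATS3.AdelicThetaDatum` (`Joshi/FundamentalEstimateBL.lean`, p428437;
R14 object-side, imported BY NAME) and slot T-10's `ATS3.ThetaLiftDatum` (p428539):
* (A) LITERAL reading — the distinguished element lifts the Tate parameters `q_{w,j}` themselves, whose residue-field
  absolute values scale as `|q_w|_{K_{y_{w,j}}} = |q_w|_{ℂ_p}^{j²/ℓ⋇²}` (valuation scaling Thm. 4.2.2.1 (4) / Cor. 4.2.2.4 normalised at
  the canonical point, the exponent E-t4/ref-x read at (9.9.4)): then the coordinate norms are `|q_w|^{j²/ℓ⋇²}` WITHOUT the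
  factor `1/2ℓ` (`LiteralStandardPointNorms`), and the local step of Thm. 7.3.1 (`LocalThetaEstimateAt`, T-12) is FALSE at
  every `ρ` — the top coordinate alone has norm `|q_w| < |q_w|^{ℓ⋇/2ℓ}` (`not_localThetaEstimateAt_of_literal`).
* (B) The literal identification `ξ_1 = q` and [J-IIp]'s size law `|ξ_1|_K = |q|_K^{1/2ℓ}` cannot hold together in one residue
  field with `0 < |q|_K < 1` (`xi_eq_tate_absurd`: `c = c^{1/2ℓ}` forces `c ∉ (0,1)`).
The CHARITABLE reading (lifts of the theta values, norms `|q_w|^{(1/2ℓ)(j²/ℓ⋇²)}`) is T-12's `StandardPointNorms`, under which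
the local step HOLDS for every `ℓ ≥ 5` (`FundamentalEstimateBLStandard.lean`, p429865). So, in kernel terms: which object is
lifted decides Thm. 7.3.1's local step; print's «Tate parameters» in Prop. 6.6.1 / p. 56 must be read as their `2ℓ`-th roots
(the theta values `ξ_1`, cf. §3.4.1 «the Tate parameter of `C/L_v` has a `2ℓ`-th root in `L′_w`», p. 29 l. 17) for the printed
proof to go through. Recorded for E-ref's sheet on (F-1); NO adjudication, no side taken on [IUTchIII] Cor. 3.12, on Joshi's
claims or on Mochizuki's report; typed ≠ proved. `LiteralStandardPointNorms` is OUR READING (a `def … : Prop`, untagged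
hypothesis), never asserted.
-/

noncomputable section

open Set Finset

namespace Summit.ABC.IUTFork.Joshi.ATS3

/-! ## (B) `ξ_1 = q` versus `|ξ_1| = |q|^{1/2ℓ}` -/

/-- Arithmetic core of (B): for `0 < c < 1` and an exponent `t < 1`, `c ≠ c^t` (indeed `c = c^1 < c^t`). [folklore] -/
theorem ne_rpow_of_lt_one {c t : ℝ} (h0 : 0 < c) (h1 : c < 1) (ht : t < 1) : c ≠ c ^ t := by
  have h : c ^ (1 : ℝ) < c ^ t := Real.rpow_lt_rpow_of_exponent_gt h0 h1 ht
  rw [Real.rpow_one] at h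
  exact h.ne

namespace ThetaLiftDatum

variable {OE B : Type*} [CommRing OE] [CommRing B] [Algebra OE B] {Y : Type*} (D : ThetaLiftDatum OE B Y)

/-- **(B) over slot T-10's lift datum**: at a point `y′` whose Tate parameter has `0 < |q|_{K_{y′}} < 1`, the LITERAL Prop. 6.6.1
identification `ξ_{1;K_{y′}} = q_{X/E,y′}` and [J-IIp] §5.1's size law `|ξ_1|_{K_{y′}} = |q|_{K_{y′}}^{1/2ℓ}` (`ℓ ≥ 1`) are jointly
absurd. [folklore] -/
theorem xi_eq_tate_absurd (y : Y) {ell : ℕ} (hell : 1 ≤ ell) (hq0 : 0 < D.absK y (D.tate y))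
    (hq1 : D.absK y (D.tate y) < 1) (hlit : D.xi y = D.tate y)
    (hsize : D.absK y (D.xi y) = D.absK y (D.tate y) ^ (1 / (2 * (ell : ℝ)))) : False := by
  rw [hlit] at hsize
  refine ne_rpow_of_lt_one hq0 hq1 ?_ hsize
  have hl : (1 : ℝ) ≤ ell := by exact_mod_cast hell
  rw [div_lt_one (by linarith)]
  linarith

end ThetaLiftDatum

/-! ## (A) the literal norm values and the local step of Thm. 7.3.1 -/

namespace AdelicThetaDatum

variable (D : AdelicThetaDatum)

/-- The exponent of the LITERAL reading at the label `j = i + 1`: `j²/ℓ⋇²` — the residue-field scaling of `|q_w|` itself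
(Thm. 4.2.2.1 (4) / Cor. 4.2.2.4, normalised so that `K_{y_{ℓ⋇}} = ℂ_p`), with NO factor `1/2ℓ`. [folklore] -/
def literalExponent (i : Fin D.lstar) : ℝ := ((((i : ℕ) : ℝ) + 1) ^ 2) / ((D.lstar : ℝ) ^ 2)

/-- **OUR READING (A), «LITERAL»**: the distinguished element lifts the Tate parameters themselves, so for `w ∈ 𝕍^{odd,ss}`,
`ρ ∈ (0,1]`, `j = 1,…,ℓ⋇`: `|Ξ^{α_w}_{0,z_Θ,w,j}|_{B_{L′_w},ρ} = |q_w|_{ℂ_{p_w}}^{j²/ℓ⋇²}` (Prop. 6.6.1 p. 48 l. 45–49 + p. 56 l. 29–37 read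
literally, with [J-IIp] Prop. 7.4.2 `|[x]|_ρ = |x| = |ψ([x])|_K` and the valuation scaling). A candidate hypothesis (our reading
of print), never asserted; contrast T-12's `StandardPointNorms` (exponent `(1/2ℓ)·(j²/ℓ⋇²)`). -/
def LiteralStandardPointNorms : Prop :=
  ∀ w ∈ D.Vss, ∀ ρ ∈ Set.Ioc (0 : ℝ) 1, ∀ i : Fin D.lstar, D.nrm w ρ (D.Xi D.std w i) = D.qAbs w ^ D.literalExponent i

/-- The literal exponents are non-negative. [folklore] -/
theorem literalExponent_nonneg (i : Fin D.lstar) : 0 ≤ D.literalExponent i := by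
  unfold literalExponent; positivity

/-- The top label `j = ℓ⋇` (index `ℓ⋇ − 1`, which exists as `ℓ⋇ ≥ 2`). [folklore] -/
def topLabel : Fin D.lstar := ⟨D.lstar - 1, Nat.sub_lt (lt_of_lt_of_le (by norm_num) D.two_le_lstar) one_pos⟩

/-- At the top label the literal exponent is `ℓ⋇²/ℓ⋇² = 1`. [folklore] -/
theorem literalExponent_top : D.literalExponent D.topLabel = 1 := by
  unfold literalExponent topLabel
  have hl : 1 ≤ D.lstar := le_trans (by norm_num) D.two_le_lstar
  have hcast : (((D.lstar - 1 : ℕ) : ℝ) + 1) = (D.lstar : ℝ) := by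
    rw [Nat.cast_sub hl]; push_cast; ring
  simp only [hcast]
  have hpos : (0 : ℝ) < (D.lstar : ℝ) ^ 2 := by
    have := D.two_le_lstar; positivity
  exact div_self hpos.ne'

/-- Under the literal norm values the local size of the distinguished element at `w ∈ 𝕍^{odd,ss}` is at most `|q_w|`: every
factor is `≤ 1` and the top factor is `|q_w|^1`. [folklore] -/
theorem localSize_std_le_qAbs_of_literal (h : D.LiteralStandardPointNorms) {w : D.W} (hw : w ∈ D.Vss) {ρ : ℝ}
    (hρ : ρ ∈ Set.Ioc (0 : ℝ) 1) : D.localSize w ρ (D.Xi D.std w) ≤ D.qAbs w := by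
  have hq0 := D.qAbs_pos w hw
  have hq1 := D.qAbs_lt_one w hw
  unfold localSize
  rw [← Finset.mul_prod_erase _ _ (Finset.mem_univ D.topLabel), h w hw ρ hρ, D.literalExponent_top, Real.rpow_one]
  have hrest : ∏ i ∈ (Finset.univ.erase D.topLabel), D.nrm w ρ (D.Xi D.std w i) ≤ 1 := by
    refine Finset.prod_le_one (fun i _ => D.nrm_nonneg w ρ _) fun i _ => ?_
    rw [h w hw ρ hρ i]
    exact Real.rpow_le_one hq0.le hq1.le (D.literalExponent_nonneg i)
  calc D.qAbs w * ∏ i ∈ (Finset.univ.erase D.topLabel), D.nrm w ρ (D.Xi D.std w i)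
      ≤ D.qAbs w * 1 := mul_le_mul_of_nonneg_left hrest hq0.le
    _ = D.qAbs w := mul_one _

/-- `|q_w| < |q_w|^{ℓ⋇/2ℓ}`: the q-side exponent `ℓ⋇/(2ℓ) = ℓ⋇/(2(2ℓ⋇+1))` is `< 1` and `0 < |q_w| < 1`. [folklore] -/
theorem qAbs_lt_qFactor {w : D.W} (hw : w ∈ D.Vss) : D.qAbs w < D.qAbs w ^ ((D.lstar : ℝ) / (2 * D.ell)) := by
  have hq0 := D.qAbs_pos w hw
  have hq1 := D.qAbs_lt_one w hw
  have hexp : (D.lstar : ℝ) / (2 * D.ell) < 1 := by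
    rw [div_lt_one (by have := D.ell_pos; positivity)]
    have : (D.ell : ℝ) = 2 * D.lstar + 1 := by unfold ell; push_cast; ring
    rw [this]
    have : (0 : ℝ) ≤ D.lstar := Nat.cast_nonneg _
    linarith
  have h := Real.rpow_lt_rpow_of_exponent_gt hq0 hq1 hexp
  rwa [Real.rpow_one] at h

/-- **(A) in kernel: under the LITERAL norm values, Thm. 7.3.1's local step FAILS at every `ρ ∈ (0,1]`** (as soon as
`𝕍^{odd,ss} ≠ ∅`, which §3.3/§3.4 provide): `|Ξ^{α_w}_{0,z_Θ,w}|_{B,ρ} ≤ |q_w| < |q_w^{1/2ℓ}|^{ℓ⋇}`, the reverse of the printed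
strict inequality p. 56 l. 48–61. Contrast `localThetaEstimateAt_of_standardPointNorms` (T-12, charitable reading: HOLDS).
[folklore] -/
theorem not_localThetaEstimateAt_of_literal (h : D.LiteralStandardPointNorms) (hne : D.Vss.Nonempty) {ρ : ℝ}
    (hρ : ρ ∈ Set.Ioc (0 : ℝ) 1) : ¬ D.LocalThetaEstimateAt ρ := by
  intro hloc
  obtain ⟨w, hw⟩ := hne
  have h1 := hloc w hw
  have h2 := D.localSize_std_le_qAbs_of_literal h hw hρ
  have h3 := D.qAbs_lt_qFactor hw
  linarith

/-- Hence under the literal reading the printed route to Thm. 7.3.1 («local step at some `ρ` ⟹ (7.3.1)»,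
`fundamentalEstimateBL_of_localThetaEstimateAt`) has NO input: `LocalThetaEstimate` is false. (Nothing is claimed about
`FundamentalEstimateBL` itself, a supremum over the whole locus.) [folklore] -/
theorem not_localThetaEstimate_of_literal (h : D.LiteralStandardPointNorms) (hne : D.Vss.Nonempty) :
    ¬ D.LocalThetaEstimate := fun hloc =>
  D.not_localThetaEstimateAt_of_literal h hne ⟨one_pos, le_rfl⟩ (hloc 1 ⟨one_pos, le_rfl⟩)

/-- The two readings differ exactly by the factor `1/2ℓ` in the exponent: `stdExponent i = (1/2ℓ) · literalExponent i`
(T-12's `stdExponent`). [folklore] -/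
theorem stdExponent_eq_mul_literal (i : Fin D.lstar) :
    D.stdExponent i = (1 / (2 * (D.ell : ℝ))) * D.literalExponent i := rfl

end AdelicThetaDatum

end Summit.ABC.IUTFork.Joshi.ATS3

end
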